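import Literature.MathematicalPhysics.QuantumFieldTheory.Balaban1983to89.B9Eq349ConjugatedQTowerLetterLinear
import Mathlib.Algebra.Order.Field.GeomSum

/-!
# `Balaban1983to89.B9Eq349ConjugatedQTowerLettersTwoBackgroundsLinear` — T. Bałaban, *Propagators for lattice gauge theories in a background field*, Commun.
# Math. Phys. **99** (1985) 389–434 [Balaban1985BackgroundPropagators] (3.15)–(3.16) p. 393, (3.35)–(3.37) p. 396, (3.49) p. 399, (3.101) p. 414: **THE CONJUGATED
# TWO-BACKGROUND `Q_k` CONSTANT IS LINEAR IN THE CLOSENESS** — the factor `T̃_{n+1}(r) − 1 = Π_{j≤n}(1 + √(L^d)·(1 + 2r·r_j)·2d·75497472(d+1)N·δ_j) − 1` of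
# `B9Eq349ConjugatedQTowerLettersTwoBackgroundsCompanion.expConj_Qk_letters_twoBackgrounds` (readings `r_0 = 3ℓ′ + L^{n+1}ι`, `r_j = 2dL^{n+1−j}ι`) obeys, under
# the companion's two windows `r(3ℓ′ + L^{n+1}ι) ≤ 1`, `r·2dL^nι ≤ 1`, the geometric level profile `δ_j ≤ δ·ϱ^j` (`0 ≤ ϱ < 1`) and ONE more window
# `√(L^d)·18d·75497472(d+1)N·δ∕(1 − ϱ) ≤ 1`:  `T̃_{n+1}(r) − 1 ≤ e·√(L^d)·18d·75497472(d+1)N∕(1 − ϱ)·δ` — LEVEL-FREE and LINEAR IN `δ` (the Lipschitz reading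
# the N52 road (α) END is for); and the conjugated ONE-family size `P′_{n+1}(r) ≤ exp(√(L^d)·(√(2d)102(d+1)²Lα_b∕(1 − ϱ) + 2√(2(2d(102(d+1)²Lα_b)² + L^{−d}))·(1 +
# 2d∕(L − 1))))` LEVEL-FREE under the bond-smallness profile `ε_j ≤ α_bϱ^j` and `L ≥ 2`

statement-level skeleton of published theorems with citation tags; proofs where landed; nothing here is a claim about the Yang–Mills mass gap

CITATION HEADER (lean-in-tree rule 2026-08-18).  Audit cell `pub-balaban`, sub-cell `t4`, NE9 crux team (2): LEAF PROVER 01 (`b2b-balaban-t4-ne9-formalise-leaf-01`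
gen 90), file 6 of the batch «the `δ_Q` ∕ `δ_Q′` conjuncts of the N52 road (α) END».  WHY: ne9-leaf-04 g85's INFO ι-2 on X-QT2 (journal l.65982): «`T̃_n − 1 ≤
(Σ_{j<n}√(L^d)β_j)·T̃_n` gives the `O(max δ_j)` Lipschitz reading the END is for (reader's arithmetic; the companion displays it or not)» — displayed here as a
theorem, Mathlib-side real arithmetic over the OWNER lineage gen 94's `B9Eq349ConjugatedQTowerLetterLinear` (t4-ne9-idea-1 g148's L-g148-3 lemmas
`prod_one_add_add_sub_prod_le_linear` etc., used BY NAME).  Print: p. 396 (3.35)–(3.37) (the level profiles), p. 399 (3.49); nothing of print's is asserted.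

WHAT IS PROVED (sorry-free; proof lane — no `def`; [folklore] real arithmetic).
* `readings_mul_le_one` — the two windows give `r·r_j ≤ 1` for every `j ≤ n` (`1 ≤ L`, `0 ≤ r`, `0 ≤ ι`).
* `beta_le_three` — `(1 + 2r·r_j)·2d·K·δ_j ≤ 3·(2d·K·δ_j)` under `r·r_j ≤ 1`.
* `sum_geometric_profile_le` — `Σ_{j≤n} δ_j ≤ δ∕(1 − ϱ)` for `δ_j ≤ δϱ^j`.
* **`towerFactor_sub_one_le_linear`** — the title's first bound.
* §2 `sum_readings_mul_le` (`Σ_{j≤n} r·r_j ≤ 1 + 2d∕(L − 1)`: the levels `j ≥ 1` are a geometric series in `L⁻¹`, `geom_sum_Ico_le_of_lt_one`, and `r·L^{n+1}ι ≤ 1`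
  from the first window), **`towerSize_le_exp`** — the title's second bound (`Π(1 + y) ≤ e^{Σy}`, `ε_j ≤ α_b`, the geometric profile, `sum_readings_mul_le`).
  Together: the companion's `δ_Q(r) ≤ M_φ′M_φ√(c₁∕(c₀L^{(n+1)d}))·exp(…)·e·√(L^d)·18dK∕(1 − ϱ)·δ`, a level-free multiple of `δ` (reader's monotonicity step on
  I-5's definitional `δ_Q`).
HONEST SCOPE.  [folklore]; crude constants (the OWNER g94's `norm_expConj_QkW_sub_le_linear` is the one-family pattern this follows); «NE9 ⇐ the named binders»; NE9 NOT PRINTED ∕ NOT PROVED; NOT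
summit progress (cell pub-balaban: row NE9 WALLED ON A MODEL (O-NE9-1; #5 UNRULED); spine PROVED 0∕9; rung (B)+1 on a finite T⁴ — NOT infinite volume, NOT mass
gap, NOT BetaPertH, NOT Clay; HONEST DEPENDENCY: continuum YM on T⁴ ⇐ BetaPertH ∧ nine spine estimates (0/9 proved); BetaPertH ⇐ (D1) ∧ (D4) ∧ CAP+tail; G-an2-4
gates asym, D1 and NE2/3/4).  NEW file; nothing modified.  Net new unproved facts: 0.
-/

namespace Literature.MathematicalPhysics.QuantumFieldTheory.Balaban1983to89.B9Eq349ConjugatedQTowerLettersTwoBackgroundsLinear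

open scoped BigOperators
open B9Eq349ConjugatedQTowerLetterLinear (prod_one_add_add_sub_prod_le_linear)

variable {d : ℕ} {L : ℕ} {n : ℕ}

/-- **THE TWO WINDOWS GIVE `r·r_j ≤ 1` AT EVERY LEVEL**: `r_0 = 3ℓ′ + L^{n+1}ι`, `r_j = 2dL^{n+1−j}ι ≤ 2dL^nι` (`j ≥ 1`, `1 ≤ L`). [folklore]
[cite: Balaban1985BackgroundPropagators, (3.49) p.399, (3.101) p.414] -/
theorem readings_mul_le_one (hL : 1 ≤ L) {r ι ℓ' : ℝ} (hr : 0 ≤ r) (hι : 0 ≤ ι)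
    (hwin0 : r * (3 * ℓ' + (L : ℝ) ^ (n + 1) * ι) ≤ 1) (hwin1 : r * (2 * d * (L : ℝ) ^ n * ι) ≤ 1) (j : ℕ) (hj : j < n + 1) :
    r * (if j = 0 then 3 * ℓ' + (L : ℝ) ^ (n + 1) * ι else 2 * d * (L : ℝ) ^ (n + 1 - j) * ι) ≤ 1 := by
  split_ifs with h
  · exact hwin0
  · have hL1 : (1 : ℝ) ≤ L := by exact_mod_cast hL
    have hle : (L : ℝ) ^ (n + 1 - j) ≤ (L : ℝ) ^ n := pow_le_pow_right₀ hL1 (by omega)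
    calc r * (2 * d * (L : ℝ) ^ (n + 1 - j) * ι) ≤ r * (2 * d * (L : ℝ) ^ n * ι) := by
          apply mul_le_mul_of_nonneg_left _ hr
          apply mul_le_mul_of_nonneg_right _ hι
          exact mul_le_mul_of_nonneg_left hle (by positivity)
      _ ≤ 1 := hwin1

/-- `r·r_j ≤ 1` and `K_j ≥ 0` ⟹ `(1 + 2r·r_j)·(2d)·K_j ≤ 3·((2d)·K_j)`. [folklore] [cite: Balaban1985BackgroundPropagators, (3.49) p.399] -/
theorem beta_le_three {x K : ℝ} (hx : x ≤ 1) (hK : 0 ≤ K) : (1 + 2 * x) * (2 * d) * K ≤ 3 * ((2 * d) * K) := by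
  have h2dK : 0 ≤ (2 * d : ℝ) * K := by positivity
  nlinarith

/-- **THE GEOMETRIC LEVEL PROFILE SUMS**: `δ_j ≤ δϱ^j` (`j ≤ n`), `0 ≤ ϱ < 1`, `0 ≤ δ` ⟹ `Σ_{j≤n} δ_j ≤ δ∕(1 − ϱ)` (`geom_sum_Ico_le_of_lt_one`). [folklore]
[cite: Balaban1985BackgroundPropagators, (3.35)–(3.37) p.396] -/
theorem sum_geometric_profile_le {δUV : ℕ → ℝ} {δ ρ : ℝ} (hδ : 0 ≤ δ) (hρ0 : 0 ≤ ρ) (hρ1 : ρ < 1)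
    (hδg : ∀ j < n + 1, δUV j ≤ δ * ρ ^ j) : ∑ j ∈ Finset.range (n + 1), δUV j ≤ δ / (1 - ρ) := by
  have h := geom_sum_Ico_le_of_lt_one (m := 0) (n := n + 1) hρ0 hρ1
  rw [pow_zero, ← Finset.range_eq_Ico] at h
  calc ∑ j ∈ Finset.range (n + 1), δUV j ≤ ∑ j ∈ Finset.range (n + 1), δ * ρ ^ j :=
        Finset.sum_le_sum fun j hj => hδg j (Finset.mem_range.1 hj)
    _ = δ * ∑ j ∈ Finset.range (n + 1), ρ ^ j := by rw [Finset.mul_sum]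
    _ ≤ δ * (1 / (1 - ρ)) := mul_le_mul_of_nonneg_left h hδ
    _ = δ / (1 - ρ) := by rw [mul_one_div]

/-- **`T̃_{n+1}(r) − 1` IS LINEAR IN THE CLOSENESS, LEVEL-FREE**: with `K = 75497472(d+1)N` (`N = (2d+2)L`), readings `r_0 = 3ℓ′ + L^{n+1}ι`, `r_j = 2dL^{n+1−j}ι`,
the two windows `r(3ℓ′ + L^{n+1}ι) ≤ 1`, `r·2dL^nι ≤ 1` (`r, ι, ℓ′ ≥ 0`), the profile `0 ≤ δ_j ≤ δϱ^j` (`j ≤ n`, `0 ≤ ϱ < 1`) and the window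
`√(L^d)·(3·(2d·K))·δ∕(1 − ϱ) ≤ 1`:
`Π_{j≤n}(1 + √(L^d)·((1 + 2(r·r_j))·(2d)·(K·δ_j))) − 1 ≤ e·(√(L^d)·(3·(2d·K))·δ∕(1 − ϱ))` — `prod_one_add_add_sub_prod_le_linear` at `x := 0` after `β_j ≤ 3·2d·K·δ_j`
and the geometric sum. [cite: Balaban1985BackgroundPropagators, (3.15)–(3.16) p.393, (3.35)–(3.37) p.396, (3.49) p.399, (3.101) p.414] -/
theorem towerFactor_sub_one_le_linear (hL : 1 ≤ L) {r ι ℓ' δ ρ : ℝ} (hr : 0 ≤ r) (hι : 0 ≤ ι) (hℓ' : 0 ≤ ℓ')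
    (hwin0 : r * (3 * ℓ' + (L : ℝ) ^ (n + 1) * ι) ≤ 1) (hwin1 : r * (2 * d * (L : ℝ) ^ n * ι) ≤ 1)
    {δUV : ℕ → ℝ} (hδUV : ∀ j, 0 ≤ δUV j) (hδ : 0 ≤ δ) (hρ0 : 0 ≤ ρ) (hρ1 : ρ < 1) (hδg : ∀ j < n + 1, δUV j ≤ δ * ρ ^ j)
    (hwinT : Real.sqrt ((L : ℝ) ^ d) * (3 * ((2 * d) * (75497472 * ((d : ℝ) + 1) * ((2 * (d * L) + L + L : ℕ) : ℝ)))) * (δ / (1 - ρ)) ≤ 1) :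
    (∏ j ∈ Finset.range (n + 1), (1 + Real.sqrt ((L : ℝ) ^ d) *
        ((1 + 2 * (r * (if j = 0 then 3 * ℓ' + (L : ℝ) ^ (n + 1) * ι else 2 * d * (L : ℝ) ^ (n + 1 - j) * ι))) * (2 * d) *
          (75497472 * ((d : ℝ) + 1) * ((2 * (d * L) + L + L : ℕ) : ℝ) * δUV j)))) - 1 ≤
      Real.exp 1 * (Real.sqrt ((L : ℝ) ^ d) * (3 * ((2 * d) * (75497472 * ((d : ℝ) + 1) * ((2 * (d * L) + L + L : ℕ) : ℝ)))) * (δ / (1 - ρ))) := by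
  set s : ℝ := Real.sqrt ((L : ℝ) ^ d) with hs
  have hs0 : 0 ≤ s := Real.sqrt_nonneg _
  set K : ℝ := 75497472 * ((d : ℝ) + 1) * ((2 * (d * L) + L + L : ℕ) : ℝ) with hK
  have hK0 : 0 ≤ K := by rw [hK]; positivity
  set rd : ℕ → ℝ := fun j => if j = 0 then 3 * ℓ' + (L : ℝ) ^ (n + 1) * ι else 2 * d * (L : ℝ) ^ (n + 1 - j) * ι with hrd
  set y : ℕ → ℝ := fun j => s * ((1 + 2 * (r * rd j)) * (2 * d) * (K * δUV j)) with hy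
  -- each summand is nonnegative and at most `s·3·(2d·K·δ_j)`
  have hrd1 : ∀ j ∈ Finset.range (n + 1), r * rd j ≤ 1 := fun j hj =>
    readings_mul_le_one hL hr hι hwin0 hwin1 j (Finset.mem_range.1 hj)
  have hrd0 : ∀ j, 0 ≤ r * rd j := fun j => by
    rw [hrd]; dsimp only; split_ifs <;> positivity
  have hy0 : ∀ j ∈ Finset.range (n + 1), 0 ≤ y j := fun j _ => by
    rw [hy]; dsimp only; have := hδUV j; have := hrd0 j; positivity
  have hyle : ∀ j ∈ Finset.range (n + 1), y j ≤ s * (3 * ((2 * d) * (K * δUV j))) := fun j hj => by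
    rw [hy]; dsimp only
    exact mul_le_mul_of_nonneg_left (beta_le_three (d := d) (hrd1 j hj) (mul_nonneg hK0 (hδUV j))) hs0
  -- the sum of the majorants: geometric profile
  have hsum : ∑ j ∈ Finset.range (n + 1), y j ≤ s * (3 * ((2 * d) * K)) * (δ / (1 - ρ)) := by
    calc ∑ j ∈ Finset.range (n + 1), y j ≤ ∑ j ∈ Finset.range (n + 1), s * (3 * ((2 * d) * (K * δUV j))) := Finset.sum_le_sum hyle
      _ = s * (3 * ((2 * d) * K)) * ∑ j ∈ Finset.range (n + 1), δUV j := by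
          rw [Finset.mul_sum]; exact Finset.sum_congr rfl fun j _ => by ring
      _ ≤ s * (3 * ((2 * d) * K)) * (δ / (1 - ρ)) :=
          mul_le_mul_of_nonneg_left (sum_geometric_profile_le hδ hρ0 hρ1 hδg) (by positivity)
  have hwin : ∑ j ∈ Finset.range (n + 1), y j ≤ 1 := hsum.trans hwinT
  -- `Π(1 + 0 + y_j) − Π(1 + 0) ≤ e·1·Σ y_j`
  have h := prod_one_add_add_sub_prod_le_linear (Finset.range (n + 1)) (x := fun _ => (0 : ℝ)) (y := y) (fun _ _ => le_rfl) hy0 hwin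
  simp only [add_zero, Finset.prod_const_one, mul_one] at h
  have e1 : ∏ j ∈ Finset.range (n + 1), (1 + s * ((1 + 2 * (r * rd j)) * (2 * d) * (K * δUV j))) = ∏ j ∈ Finset.range (n + 1), (1 + y j) :=
    Finset.prod_congr rfl fun j _ => by rw [hy]
  rw [e1]
  calc ∏ j ∈ Finset.range (n + 1), (1 + y j) - 1 ≤ Real.exp 1 * ∑ j ∈ Finset.range (n + 1), y j := h
    _ ≤ Real.exp 1 * (s * (3 * ((2 * d) * K)) * (δ / (1 - ρ))) := mul_le_mul_of_nonneg_left hsum (Real.exp_pos 1).le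

/-! ## §2 The conjugated one-family size `P′_{n+1}(r)` is level-free -/

/-- **THE READINGS SUM LEVEL-FREE**: `Σ_{j≤n} r·r_j ≤ 1 + 2d∕(L − 1)` for `L ≥ 2` under the first window (`r·L^{n+1}ι ≤ r(3ℓ′ + L^{n+1}ι) ≤ 1`; the levels
`j ≥ 1` are a geometric series in `L⁻¹`: `Σ_{1≤j≤n} L^{n+1−j} ≤ L^{n+1}∕(L − 1)`). [folklore] [cite: Balaban1985BackgroundPropagators, (3.15)–(3.16) p.393, (3.49) p.399, (3.101) p.414] -/
theorem sum_readings_mul_le (hL : 2 ≤ L) {r ι ℓ' : ℝ} (hr : 0 ≤ r) (hι : 0 ≤ ι) (hℓ' : 0 ≤ ℓ')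
    (hwin0 : r * (3 * ℓ' + (L : ℝ) ^ (n + 1) * ι) ≤ 1) :
    ∑ j ∈ Finset.range (n + 1), r * (if j = 0 then 3 * ℓ' + (L : ℝ) ^ (n + 1) * ι else 2 * d * (L : ℝ) ^ (n + 1 - j) * ι) ≤
      1 + 2 * d / ((L : ℝ) - 1) := by
  have hL1 : (1 : ℝ) < L := by exact_mod_cast hL
  have hL0 : (0 : ℝ) < L := by linarith
  have hLinv0 : (0 : ℝ) ≤ (L : ℝ)⁻¹ := by positivity
  have hLinv1 : (L : ℝ)⁻¹ < 1 := inv_lt_one_of_one_lt₀ hL1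
  -- the top reading `r·L^{n+1}ι ≤ 1`
  have htop : r * ((L : ℝ) ^ (n + 1) * ι) ≤ 1 := by
    have : r * ((L : ℝ) ^ (n + 1) * ι) ≤ r * (3 * ℓ' + (L : ℝ) ^ (n + 1) * ι) := mul_le_mul_of_nonneg_left (by linarith) hr
    exact this.trans hwin0
  -- split off `j = 0`
  rw [Finset.sum_range_succ']
  simp only [Nat.succ_ne_zero, if_false, if_true]
  -- the levels `j+1`, `j < n`: `L^{n+1−(j+1)} = L^{n+1}·(L⁻¹)^{j+1}`
  have hpow : ∀ j ∈ Finset.range n, (L : ℝ) ^ (n + 1 - (j + 1)) = (L : ℝ) ^ (n + 1) * ((L : ℝ)⁻¹) ^ (j + 1) := by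
    intro j hj
    have hj' : j + 1 ≤ n + 1 := by have := Finset.mem_range.1 hj; omega
    rw [inv_pow, pow_sub₀ _ hL0.ne' hj']
  have hgeom : ∑ j ∈ Finset.range n, ((L : ℝ)⁻¹) ^ (j + 1) ≤ 1 / ((L : ℝ) - 1) := by
    have h := geom_sum_Ico_le_of_lt_one (m := 1) (n := n + 1) hLinv0 hLinv1
    rw [Finset.sum_Ico_eq_sum_range] at h
    simp only [Nat.add_sub_cancel, pow_one] at h
    have e : (L : ℝ)⁻¹ / (1 - (L : ℝ)⁻¹) = 1 / ((L : ℝ) - 1) := by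
      field_simp
    rw [e] at h
    refine le_trans (le_of_eq (Finset.sum_congr rfl fun j _ => by rw [add_comm])) h
  calc ∑ j ∈ Finset.range n, r * (2 * d * (L : ℝ) ^ (n + 1 - (j + 1)) * ι) + r * (3 * ℓ' + (L : ℝ) ^ (n + 1) * ι)
      = 2 * d * (r * ((L : ℝ) ^ (n + 1) * ι)) * ∑ j ∈ Finset.range n, ((L : ℝ)⁻¹) ^ (j + 1) + r * (3 * ℓ' + (L : ℝ) ^ (n + 1) * ι) := by
        rw [Finset.mul_sum]
        congr 1
        exact Finset.sum_congr rfl fun j hj => by rw [hpow j hj]; ring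
    _ ≤ 2 * d * 1 * (1 / ((L : ℝ) - 1)) + 1 := by
        have h2 : 0 ≤ ∑ j ∈ Finset.range n, ((L : ℝ)⁻¹) ^ (j + 1) := Finset.sum_nonneg fun j _ => by positivity
        have h3 : 2 * d * (r * ((L : ℝ) ^ (n + 1) * ι)) ≤ 2 * d * 1 := mul_le_mul_of_nonneg_left htop (by positivity)
        have h4 : 0 ≤ 2 * d * (r * ((L : ℝ) ^ (n + 1) * ι)) := by positivity
        nlinarith [mul_le_mul h3 hgeom h2 (by positivity : (0:ℝ) ≤ 2 * d * 1)]
    _ = 1 + 2 * d / ((L : ℝ) - 1) := by ring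

/-- **`P′_{n+1}(r)` IS LEVEL-FREE**: with the bond-smallness profile `ε_j ≤ α_b·ϱ^j` (`0 ≤ ϱ < 1`, so `ε_j ≤ α_b`), `L ≥ 2` and the first window,
`Π_{j≤n}(1 + √(L^d)(θ_j + e_j(r))) ≤ exp(√(L^d)·(√(2d)·102(d+1)²L·α_b∕(1 − ϱ) + 2·√(2(2d(102(d+1)²Lα_b)² + L^{−d}))·(1 + 2d∕(L − 1))))`, `θ_j = √(2d)102(d+1)²Lε_j`,
`e_j(r) = 2(r·r_j)√(2(2d(102(d+1)²Lε_j)² + L^{−d}))` (`Π(1 + y) ≤ e^{Σy}`, the geometric profile, `sum_readings_mul_le`).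
[cite: Balaban1985BackgroundPropagators, (3.15)–(3.16) p.393, (3.35)–(3.37) p.396, (3.49) p.399, (3.101) p.414] -/
theorem towerSize_le_exp (hL : 2 ≤ L) {r ι ℓ' αb ρ : ℝ} (hr : 0 ≤ r) (hι : 0 ≤ ι) (hℓ' : 0 ≤ ℓ')
    (hwin0 : r * (3 * ℓ' + (L : ℝ) ^ (n + 1) * ι) ≤ 1)
    {εU : ℕ → ℝ} (hεU : ∀ j, 0 ≤ εU j) (hαb : 0 ≤ αb) (hρ0 : 0 ≤ ρ) (hρ1 : ρ < 1) (hεg : ∀ j < n + 1, εU j ≤ αb * ρ ^ j) :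
    ∏ j ∈ Finset.range (n + 1), (1 + Real.sqrt ((L : ℝ) ^ d) * (Real.sqrt (2 * d) * (102 * (d + 1) ^ 2 * L * εU j) +
        2 * (r * (if j = 0 then 3 * ℓ' + (L : ℝ) ^ (n + 1) * ι else 2 * d * (L : ℝ) ^ (n + 1 - j) * ι)) *
          Real.sqrt (2 * (2 * d * (102 * (d + 1) ^ 2 * L * εU j) ^ 2 + ((L : ℝ) ^ d)⁻¹)))) ≤
      Real.exp (Real.sqrt ((L : ℝ) ^ d) * (Real.sqrt (2 * d) * (102 * (d + 1) ^ 2 * L) * (αb / (1 - ρ)) +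
        2 * Real.sqrt (2 * (2 * d * (102 * (d + 1) ^ 2 * L * αb) ^ 2 + ((L : ℝ) ^ d)⁻¹)) * (1 + 2 * d / ((L : ℝ) - 1)))) := by
  have hL1 : 1 ≤ L := by omega
  set s : ℝ := Real.sqrt ((L : ℝ) ^ d) with hs
  have hs0 : 0 ≤ s := Real.sqrt_nonneg _
  set c : ℝ := 102 * (d + 1) ^ 2 * L with hc
  have hc0 : 0 ≤ c := by rw [hc]; positivity
  set rd : ℕ → ℝ := fun j => if j = 0 then 3 * ℓ' + (L : ℝ) ^ (n + 1) * ι else 2 * d * (L : ℝ) ^ (n + 1 - j) * ι with hrd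
  set Wm : ℝ := Real.sqrt (2 * (2 * d * (c * αb) ^ 2 + ((L : ℝ) ^ d)⁻¹)) with hWm
  have hWm0 : 0 ≤ Wm := Real.sqrt_nonneg _
  have hrd0 : ∀ j, 0 ≤ r * rd j := fun j => by rw [hrd]; dsimp only; split_ifs <;> positivity
  -- `ε_j ≤ α_b`
  have hεle : ∀ j ∈ Finset.range (n + 1), εU j ≤ αb := fun j hj => by
    have h := hεg j (Finset.mem_range.1 hj)
    exact h.trans (mul_le_of_le_one_right hαb (pow_le_one₀ hρ0 hρ1.le))
  -- the summands
  set y : ℕ → ℝ := fun j => s * (Real.sqrt (2 * d) * (c * εU j) + 2 * (r * rd j) * Real.sqrt (2 * (2 * d * (c * εU j) ^ 2 + ((L : ℝ) ^ d)⁻¹))) with hy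
  have hy0 : ∀ j ∈ Finset.range (n + 1), 0 ≤ y j := fun j _ => by
    rw [hy]; dsimp only; have := hεU j; have := hrd0 j; positivity
  have hyle : ∀ j ∈ Finset.range (n + 1), y j ≤ s * (Real.sqrt (2 * d) * c * εU j) + s * (2 * Wm) * (r * rd j) := fun j hj => by
    rw [hy]; dsimp only
    have hW : Real.sqrt (2 * (2 * d * (c * εU j) ^ 2 + ((L : ℝ) ^ d)⁻¹)) ≤ Wm := by
      rw [hWm]
      apply Real.sqrt_le_sqrt
      have : (c * εU j) ^ 2 ≤ (c * αb) ^ 2 := pow_le_pow_left₀ (mul_nonneg hc0 (hεU j)) (mul_le_mul_of_nonneg_left (hεle j hj) hc0) 2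
      nlinarith
    have h1 : 2 * (r * rd j) * Real.sqrt (2 * (2 * d * (c * εU j) ^ 2 + ((L : ℝ) ^ d)⁻¹)) ≤ 2 * (r * rd j) * Wm :=
      mul_le_mul_of_nonneg_left hW (by have := hrd0 j; positivity)
    nlinarith [mul_le_mul_of_nonneg_left h1 hs0]
  have hprod : ∏ j ∈ Finset.range (n + 1), (1 + y j) ≤ Real.exp (∑ j ∈ Finset.range (n + 1), y j) :=
    B9Eq349ConjugatedQTowerLetterLinear.prod_one_add_le_exp_sum _ hy0
  have hsum : ∑ j ∈ Finset.range (n + 1), y j ≤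
      s * (Real.sqrt (2 * d) * c * (αb / (1 - ρ))) + s * (2 * Wm) * (1 + 2 * d / ((L : ℝ) - 1)) := by
    calc ∑ j ∈ Finset.range (n + 1), y j
        ≤ ∑ j ∈ Finset.range (n + 1), (s * (Real.sqrt (2 * d) * c * εU j) + s * (2 * Wm) * (r * rd j)) := Finset.sum_le_sum hyle
      _ = s * (Real.sqrt (2 * d) * c) * ∑ j ∈ Finset.range (n + 1), εU j + s * (2 * Wm) * ∑ j ∈ Finset.range (n + 1), r * rd j := by
          rw [Finset.sum_add_distrib, Finset.mul_sum, Finset.mul_sum]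
          congr 1
          exact Finset.sum_congr rfl fun j _ => by ring
      _ ≤ s * (Real.sqrt (2 * d) * c) * (αb / (1 - ρ)) + s * (2 * Wm) * (1 + 2 * d / ((L : ℝ) - 1)) :=
          add_le_add (mul_le_mul_of_nonneg_left (sum_geometric_profile_le hαb hρ0 hρ1 hεg) (by positivity))
            (mul_le_mul_of_nonneg_left (sum_readings_mul_le (d := d) hL hr hι hℓ' hwin0) (by positivity))
      _ = _ := by ring
  have e1 : ∏ j ∈ Finset.range (n + 1), (1 + s * (Real.sqrt (2 * d) * (c * εU j) +
      2 * (r * rd j) * Real.sqrt (2 * (2 * d * (c * εU j) ^ 2 + ((L : ℝ) ^ d)⁻¹)))) = ∏ j ∈ Finset.range (n + 1), (1 + y j) :=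
    Finset.prod_congr rfl fun j _ => by rw [hy]
  rw [e1]
  refine hprod.trans (Real.exp_le_exp.2 (hsum.trans (le_of_eq ?_)))
  ring

end Literature.MathematicalPhysics.QuantumFieldTheory.Balaban1983to89.B9Eq349ConjugatedQTowerLettersTwoBackgroundsLinear
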